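import Summits.QuantumFields.YangMills.Theorems.BalabanLadderIRTwistedSlabOrbitConstant
import Summits.QuantumFields.YangMills.Theorems.BalabanLadderIRTwistedSlabFaddeevPopovJacobian
import HarnessLib

/-!
# The orbit constants of the twisted slab with PINNED window constants: the gauge-group Haar chart with its density at the origin identified
# (`hd(0) = σ₀(𝒢; λ)`), and K25's closed-form Laplace limit with `h₀` explicit — THE NUMBER's gauge-volume factor

HELPER toward stub **T1** `TwistedSlabAnchor` (LINE `twisted-slab-continuity`, crux `IRcof` stmt-QuantumFields-26930, census row 43;
LEAD prover ym-ir-line-tsc-p1 g4; `--supports` the crux, `--as helper`).  Sequel of K25 `…OrbitConstant` (whose `h₀` is existential) and K28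
`…FaddeevPopovJacobian` (`suPiWindowConst`); lit-4 L24 `tendsto_laplaceMethod_sum_orbits_closedForm` and L25 `exists_haarChart_expChart_frame` (9th clause:
`hd 0 = σ₀`) BY NAME.  Norm scope `Matrix.Norms.L2Operator`.
* §1 `suFieldsLie` — the identity frame `suFields ≃L 𝔤^{sites}` (K25's local `F`, now a definition); ★★ `exists_haarChart_expGauge_eq`: K25 §1 with the density
  at the origin IDENTIFIED, `hd 0 = suPiWindowConst sites (vol_M ∘ (suFieldsLie ∘ T_M)⁻¹) ν`.
* §2 ★★★ `tendsto_laplace_sum_orbits_twistedExponent_pinned`: K25 §3 with `h₀ := suPiWindowConst sites (vol_M ∘ (suFieldsLie ∘ T_M)⁻¹) ν` — no existential left: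
  `β^{m/2} ∫ e^{−β tE_k} φ dHaar → Σ_p (2π)^{m/2} ν(𝒢) J_p(0) ∕ (N σ₀(𝒢)) · φ(ladder_p) ∕ √det A_p`.
NOT here (honest scope): the evaluation `J_p(0) = √det_ℝΔ · σ₀(𝔤^E)` (K28) at product reference frames, `σ₀(𝔤^B) = σ₀(𝔤)^{|B|}` (lit-4 L26), `det A_p = (det_ℝΔ)³`
(K27) and the assembly of THE NUMBER (K30); anything uniform in `β` (M3) or `L, t` (M4); T1-box 0∕1, T1 proper 0∕1.

HONEST FRAMING: the classical (`β → ∞`) limit at ONE fixed box; nothing here bears on `IRcof`, `IR`, or the Yang–Mills mass gap (Clay: NOT proved); R4 =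
`BalabanLadder.UV` only.  References: S. Helgason (2000) Ch. I §1 Thm 1.14 (13) p. 96; E. Hasenpflug, D. Rudolf, B. Sprungk (2024) App. 4.1 Thm 16 ∕ Remark 17;
C.-R. Hwang (1980); T. Bałaban, CMP 102 (1985) p. 260.
-/

set_option autoImplicit false

noncomputable section

open scoped Matrix Matrix.Norms.L2Operator Topology ENNReal InnerProductSpace Pointwise
open MeasureTheory Filter NormedSpace Set Metric Module
open Literature.MathematicalPhysics.QuantumFieldTheory Literature.MathematicalPhysics.QuantumLattice
open Literature.MathematicalPhysics.QuantumFieldTheory.Balaban1983to89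
open Literature.MathematicalPhysics.QuantumFieldTheory.Balaban1983to89.HaarExponentialChart
open Literature.MathematicalPhysics.QuantumFieldTheory.Balaban1983to89.LogChartProduct
open Literature.Analysis.Asymptotics Literature.MeasureTheory.Group
open Literature.Analysis.OperatorTheory Literature.Analysis.InnerProduct

namespace Summit.QuantumFields.YangMills.Cruxes.IRcof.TwistedSlab

variable {N : ℕ} [NeZero N]

/-! ## §1 The identity frame `suFields ≃ 𝔤^{sites}` and the gauge-group Haar chart with identified density at the origin -/

section HaarChart

variable {n₀ n₁ n₂ n₃ : ℕ}
variable {M : Type*} [NormedAddCommGroup M] [InnerProductSpace ℝ M] [FiniteDimensional ℝ M] [MeasurableSpace M] [BorelSpace M]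

/-- **The identity frame** `suFields ≃L 𝔤^{sites}`: an `𝔰𝔲`-valued site field IS an element of the Lie algebra of B89's product chart of `SU(N)^{sites}`.
[cite: Helgason2000, Ch. I §1 Thm 1.14 p. 96] -/
def suFieldsLie : suFields N n₀ n₁ n₂ n₃ ≃L[ℝ] (piLogChart (specialUnitaryLogChart (Fin N)) (FinTorusSite n₀ n₁ n₂ n₃)).lie :=
  LinearEquiv.toContinuousLinearEquiv
    { toFun := fun φ => ⟨(φ : FinTorusSite n₀ n₁ n₂ n₃ → Matrix (Fin N) (Fin N) ℂ), (mem_piLogChart_lie _ _).2 fun x =>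
        mem_specialUnitaryLogChart_lie.2 (by rw [Matrix.star_eq_conjTranspose]; exact φ.2 x)⟩
      invFun := fun X => ⟨(X : FinTorusSite n₀ n₁ n₂ n₃ → Matrix (Fin N) (Fin N) ℂ), mem_suFields.2 fun x => by
        have h := mem_specialUnitaryLogChart_lie.1 ((mem_piLogChart_lie _ _).1 X.2 x)
        rwa [Matrix.star_eq_conjTranspose] at h⟩
      map_add' := fun _ _ => rfl
      map_smul' := fun _ _ => rfl
      left_inv := fun _ => rfl
      right_inv := fun _ => rfl }

/-- Unfolding lemma. [folklore] -/
@[simp] theorem coe_suFieldsLie (φ : suFields N n₀ n₁ n₂ n₃) :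
    ((suFieldsLie φ : (piLogChart (specialUnitaryLogChart (Fin N)) (FinTorusSite n₀ n₁ n₂ n₃)).lie) : FinTorusSite n₀ n₁ n₂ n₃ → Matrix (Fin N) (Fin N) ℂ) =
      (φ : FinTorusSite n₀ n₁ n₂ n₃ → Matrix (Fin N) (Fin N) ℂ) := rfl

/-- B89's product chart through the identity frame IS the exponential gauge chart: `Θ^{sites}(suFieldsLie φ) = expGauge φ`. [cite: Helgason2000, Ch. I §1 Thm 1.14 p. 96] -/
theorem expChart_pi_suFieldsLie (φ : suFields N n₀ n₁ n₂ n₃) :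
    (isChartRep_pi (FinTorusSite n₀ n₁ n₂ n₃) (isChartRep_specialUnitaryGroup (n := Fin N))).expChart (suFieldsLie φ) = expGauge φ := by
  funext x
  rw [expChart_pi_apply _ (isChartRep_specialUnitaryGroup (n := Fin N))]
  apply fundamentalRep_injective (Fin N)
  rw [(isChartRep_specialUnitaryGroup (n := Fin N)).rho_expChart, fundamentalRep_apply, coe_expGauge_apply, coe_lieApply]
  rfl

/-- ★★ **THE HAAR CHART OF THE GAUGE GROUP, DENSITY AT THE ORIGIN IDENTIFIED** (K25 `exists_haarChart_expGauge` + the 9th clause of lit-4 L25): for every frame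
`T_M : M ≃L suFields` and every Haar measure `ν` on `𝒢` there are an open `U ∋ 0` and a continuous `hd ≥ 0` with `hd 0 > 0`,
`hd 0 = σ₀(𝒢; vol_M ∘ (suFieldsLie ∘ T_M)⁻¹) = suPiWindowConst sites (vol_M.map (suFieldsLie ∘ T_M)) ν`, `e = expGauge ∘ T_M` injective on `U`, and
`ν|_{e(U)} = e_*((hd · vol_M)|_U)`. [cite: Helgason2000, Ch. I §1 Thm 1.14 (13) p. 96] [cite: Balaban1985UV3, p. 260] -/
theorem exists_haarChart_expGauge_eq (T_M : M ≃L[ℝ] suFields N n₀ n₁ n₂ n₃)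
    (ν : Measure (FinTorusSite n₀ n₁ n₂ n₃ → Matrix.specialUnitaryGroup (Fin N) ℂ)) [ν.IsHaarMeasure] :
    letI : MeasurableSpace (piLogChart (specialUnitaryLogChart (Fin N)) (FinTorusSite n₀ n₁ n₂ n₃)).lie := borel _
    ∃ (U : Set M) (hd : M → ℝ), IsOpen U ∧ (0 : M) ∈ U ∧ InjOn (fun z : M => expGauge (T_M z)) U ∧ Continuous hd ∧ (∀ z, 0 ≤ hd z) ∧ 0 < hd 0 ∧
      hd 0 = suPiWindowConst (FinTorusSite n₀ n₁ n₂ n₃) ((volume : Measure M).map fun z => suFieldsLie (T_M z)) ν ∧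
      ν.restrict ((fun z : M => expGauge (T_M z)) '' U) =
        (((volume : Measure M).restrict U).withDensity fun z => ENNReal.ofReal (hd z)).map (fun z : M => expGauge (T_M z)) := by
  letI : MeasurableSpace (piLogChart (specialUnitaryLogChart (Fin N)) (FinTorusSite n₀ n₁ n₂ n₃)).lie := borel _
  haveI : BorelSpace (piLogChart (specialUnitaryLogChart (Fin N)) (FinTorusSite n₀ n₁ n₂ n₃)).lie := ⟨rfl⟩
  haveI : FiniteDimensional ℝ (piLogChart (specialUnitaryLogChart (Fin N)) (FinTorusSite n₀ n₁ n₂ n₃)).lie := finiteDimensional_piLogChart_lie _ _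
  set e : M ≃L[ℝ] (piLogChart (specialUnitaryLogChart (Fin N)) (FinTorusSite n₀ n₁ n₂ n₃)).lie := T_M.trans suFieldsLie with he_def
  have he : (fun v : M => (isChartRep_pi (FinTorusSite n₀ n₁ n₂ n₃) (isChartRep_specialUnitaryGroup (n := Fin N))).expChart (e v)) =
      fun z : M => expGauge (T_M z) := by
    funext v
    exact expChart_pi_suFieldsLie (T_M v)
  obtain ⟨U, hd, hUo, h0U, hinj, hdc, hd0, hd00, hσ, hchart⟩ := exists_haarChart_expChart_frame
    (isChartRep_pi (FinTorusSite n₀ n₁ n₂ n₃) (isChartRep_specialUnitaryGroup (n := Fin N)))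
    (lie_adStable_pi (specialUnitaryLogChart (Fin N)) (FinTorusSite n₀ n₁ n₂ n₃) (lie_adStable_specialUnitaryGroup (n := Fin N))) ν e
  rw [he] at hinj hchart
  refine ⟨U, hd, hUo, h0U, hinj, hdc, hd0, hd00, ?_, hchart⟩
  have he_fun : (⇑e : M → (piLogChart (specialUnitaryLogChart (Fin N)) (FinTorusSite n₀ n₁ n₂ n₃)).lie) = fun z => suFieldsLie (T_M z) := rfl
  rw [hσ, he_fun]
  rfl

end HaarChart

/-! ## §2 The `N²`-orbit Laplace asymptotics with PINNED constants -/

section Main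

variable {m m₂ m₃ : ℕ}
variable {M : Type*} [NormedAddCommGroup M] [InnerProductSpace ℝ M] [FiniteDimensional ℝ M] [MeasurableSpace M] [BorelSpace M]
variable {V : Type*} [NormedAddCommGroup V] [InnerProductSpace ℝ V] [FiniteDimensional ℝ V] [MeasurableSpace V] [BorelSpace V]

/-- ★★★ **LAPLACE ON THE `N²` CRITICAL ORBITS, PINNED CONSTANTS** (K25 `…_closedForm` with the gauge-group window constant made explicit): in the setting of
K23∕K25, `β^{dim V/2} ∫ e^{−β·twistedExponent k} φ dHaar ⟶ Σ_{(i,j)} (2π)^{dim V/2} · ν(𝒢) · J_{ij}(0) ∕ (N · σ₀(𝒢; vol_M ∘ (suFieldsLie ∘ T_M)⁻¹)) · φ(ladder_{ij}) ∕ √det A_{ij}`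
where `σ₀(𝒢; λ) = suPiWindowConst sites λ ν` is the window constant of B89's product chart of the gauge group `𝒢 = SU(N)^{sites}` for the frame's Lebesgue measure
(`J_{ij}(0)` = K17's fibred chart density at the origin, `A_{ij}` = K19's slice Hessian; `|Z_N| = N`).  ONE CALL of lit-4 L24, as in K25.
[cite: HasenpflugRudolfSprungk2024, §3.4 and App. 4.1 Thm 16 ∕ Remark 17] [cite: Hwang1980, main theorem] [cite: Helgason2000, Ch. I §1 Thm 1.14 (13) p. 96] -/
theorem tendsto_laplace_sum_orbits_twistedExponent_pinned {k : ZMod N} (hk : IsUnit k) {A B : Matrix.specialUnitaryGroup (Fin N) ℂ}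
    (hAB : B * A * B⁻¹ * A⁻¹ = (suCenter N k : Matrix.specialUnitaryGroup (Fin N) ℂ)) (hNm : 2 ≤ N * (m + 1))
    (T_M : M ≃L[ℝ] suFields N (m + 1) (m + 1) (m₂ + 1) (m₃ + 1))
    (T_V : ∀ p : ZMod N × ZMod N, V ≃L[ℝ] realCoulombSlice (ladderField (n₀ := m + 1) (n₁ := m + 1) (n₂ := m₂ + 1) (n₃ := m₃ + 1)
      ![(A : Matrix (Fin N) (Fin N) ℂ), (B : Matrix (Fin N) (Fin N) ℂ), centerPhase N p.1 • (1 : Matrix (Fin N) (Fin N) ℂ), centerPhase N p.2 • (1 : Matrix (Fin N) (Fin N) ℂ)]))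
    {φ : (FinTorusSite (m + 1) (m + 1) (m₂ + 1) (m₃ + 1) × Fin 4 → Matrix.specialUnitaryGroup (Fin N) ℂ) → ℝ} (hφ : Continuous φ)
    (hφinv : ∀ (g : FinTorusSite (m + 1) (m + 1) (m₂ + 1) (m₃ + 1) → Matrix.specialUnitaryGroup (Fin N) ℂ) U, φ (gaugeAct g U) = φ U) :
    letI : MeasurableSpace (piLogChart (specialUnitaryLogChart (Fin N)) (FinTorusSite (m + 1) (m + 1) (m₂ + 1) (m₃ + 1))).lie := borel _
    Tendsto (fun β : ℝ => β ^ ((finrank ℝ V : ℝ) / 2) *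
          ∫ U, Real.exp (-β * twistedExponent k U) * φ U ∂(Measure.pi fun _ => haarProbability (Matrix.specialUnitaryGroup (Fin N) ℂ))) atTop
        (𝓝 (∑ p : ZMod N × ZMod N, (2 * Real.pi) ^ ((finrank ℝ V : ℝ) / 2) *
          ((Measure.pi fun _ : FinTorusSite (m + 1) (m + 1) (m₂ + 1) (m₃ + 1) => haarProbability (Matrix.specialUnitaryGroup (Fin N) ℂ)).real univ *
            (fibredChartDensity (ladderFieldPair_mem_specialUnitaryGroup A B p.1 p.2)
                (slicePsiSuDeriv (Matrix.specialUnitaryGroup_le_unitaryGroup A.2) (Matrix.specialUnitaryGroup_le_unitaryGroup B.2)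
                  (isPrimitiveRoot_star_centerPhase (N := N) hk) (coe_mul_eq_smul_of_commutator_eq hAB) hNm (ladderFieldPair_mem_specialUnitaryGroup A B p.1 p.2))
                (prodFrame T_M (T_V p)) (Measure.pi fun _ => haarProbability (Matrix.specialUnitaryGroup (Fin N) ℂ)) 0 /
              ((N : ℝ) * suPiWindowConst (FinTorusSite (m + 1) (m + 1) (m₂ + 1) (m₃ + 1)) ((volume : Measure M).map fun z => suFieldsLie (T_M z))
                (Measure.pi fun _ : FinTorusSite (m + 1) (m + 1) (m₂ + 1) (m₃ + 1) => haarProbability (Matrix.specialUnitaryGroup (Fin N) ℂ))) *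
            φ (ladderConfig ![A, B, (suCenter N p.1 : Matrix.specialUnitaryGroup (Fin N) ℂ), (suCenter N p.2 : Matrix.specialUnitaryGroup (Fin N) ℂ)]) /
            Real.sqrt (LinearMap.det (sliceHessian (fun e => (⟨ladderField (n₀ := m + 1) (n₁ := m + 1) (n₂ := m₂ + 1) (n₃ := m₃ + 1)
              ![(A : Matrix (Fin N) (Fin N) ℂ), (B : Matrix (Fin N) (Fin N) ℂ), centerPhase N p.1 • (1 : Matrix (Fin N) (Fin N) ℂ),
                centerPhase N p.2 • (1 : Matrix (Fin N) (Fin N) ℂ)] e, ladderFieldPair_mem_specialUnitaryGroup A B p.1 p.2 e⟩ : Matrix.specialUnitaryGroup (Fin N) ℂ))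
              (T_V p) k)))))) := by
  classical
  letI : MeasurableSpace (piLogChart (specialUnitaryLogChart (Fin N)) (FinTorusSite (m + 1) (m + 1) (m₂ + 1) (m₃ + 1))).lie := borel _
  have hAu : (A : Matrix (Fin N) (Fin N) ℂ) ∈ Matrix.unitaryGroup (Fin N) ℂ := Matrix.specialUnitaryGroup_le_unitaryGroup A.2
  have hBu : (B : Matrix (Fin N) (Fin N) ℂ) ∈ Matrix.unitaryGroup (Fin N) ℂ := Matrix.specialUnitaryGroup_le_unitaryGroup B.2
  have hω := isPrimitiveRoot_star_centerPhase (N := N) hk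
  have hAB' := coe_mul_eq_smul_of_commutator_eq hAB
  have hL : ∀ p : ZMod N × ZMod N, ∀ e : FinTorusSite (m + 1) (m + 1) (m₂ + 1) (m₃ + 1) × Fin 4,
      ladderField ![(A : Matrix (Fin N) (Fin N) ℂ), (B : Matrix (Fin N) (Fin N) ℂ), centerPhase N p.1 • (1 : Matrix (Fin N) (Fin N) ℂ),
        centerPhase N p.2 • (1 : Matrix (Fin N) (Fin N) ℂ)] e ∈ Matrix.specialUnitaryGroup (Fin N) ℂ :=
    fun p => ladderFieldPair_mem_specialUnitaryGroup A B p.1 p.2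
  -- the chart data of every orbit (K20a)
  choose r hr hinj hJc hmeas hchart using fun p : ZMod N × ZMod N =>
    exists_ball_prod_hloc_ladder (M := M) (V := V) hAu hBu hω hAB' hNm (hL p) (prodFrame T_M (T_V p))
      (Measure.pi fun _ => haarProbability (Matrix.specialUnitaryGroup (Fin N) ℂ))
  -- the chart is open at the origin (K22)
  have hΘ'𝓝 : ∀ p : ZMod N × ZMod N, 𝓝 ((fun (p : ZMod N × ZMod N) (y : V) => sliceCfg (hL p) (T_V p y)) p 0) ≤
      map (fibredChartMap (hL p) (prodFrame T_M (T_V p))) (𝓝 0) := by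
    intro p
    obtain ⟨W, -, hW0, hW⟩ := exists_isOpen_forall_nhds_le_map_fibredChartMap hAu hBu hω hAB' hNm (hL p) (prodFrame T_M (T_V p))
    have h := hW 0 hW0
    rwa [fibredChartMap_prodFrame_zero] at h
  -- the box `closedBall (r/2) × {0}` inside the product window
  have hρW : ∀ p : ZMod N × ZMod N, closedBall (0 : M) (r p / 2) ×ˢ {(0 : V)} ⊆ ball (0 : M) (r p) ×ˢ ball (0 : V) (r p) := by
    rintro p ⟨z, y⟩ ⟨hz, hy⟩
    rw [mem_singleton_iff] at hy
    subst hy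
    exact ⟨closedBall_subset_ball (by linarith [hr p]) hz, mem_ball_self (hr p)⟩
  -- stabiliser
  have hstab : ∀ (p : ZMod N × ZMod N) (g : FinTorusSite (m + 1) (m + 1) (m₂ + 1) (m₃ + 1) → Matrix.specialUnitaryGroup (Fin N) ℂ),
      gaugeAct g ((fun (p : ZMod N × ZMod N) (y : V) => sliceCfg (hL p) (T_V p y)) p 0) =
        (fun (p : ZMod N × ZMod N) (y : V) => sliceCfg (hL p) (T_V p y)) p 0 →
      g ∈ (fun _ : ZMod N × ZMod N => {g : FinTorusSite (m + 1) (m + 1) (m₂ + 1) (m₃ + 1) → Matrix.specialUnitaryGroup (Fin N) ℂ |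
        ∃ c ∈ Subgroup.zpowers (suCenter N k : Matrix.specialUnitaryGroup (Fin N) ℂ), g = fun _ => c}) p := by
    intro p g hg
    simp only [map_zero, sliceCfg_zero_eq_ladderConfig] at hg
    exact mem_constCenterGauge_of_gaugeAct_ladder_eq hk hAB p.1 p.2 g hg
  -- the Peano expansion along the transversal (K19)
  have hS2 : ∀ p : ZMod N × ZMod N, (fun y : V => twistedExponent k ((fun (p : ZMod N × ZMod N) (y : V) => sliceCfg (hL p) (T_V p y)) p y) -
      twistedExponent k ((fun (p : ZMod N × ZMod N) (y : V) => sliceCfg (hL p) (T_V p y)) p 0) -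
      (1 / 2) * ⟪sliceHessian (fun e => (⟨ladderField (n₀ := m + 1) (n₁ := m + 1) (n₂ := m₂ + 1) (n₃ := m₃ + 1)
        ![(A : Matrix (Fin N) (Fin N) ℂ), (B : Matrix (Fin N) (Fin N) ℂ), centerPhase N p.1 • (1 : Matrix (Fin N) (Fin N) ℂ),
          centerPhase N p.2 • (1 : Matrix (Fin N) (Fin N) ℂ)] e, hL p e⟩ : Matrix.specialUnitaryGroup (Fin N) ℂ)) (T_V p) k y, y⟫_ℝ) =o[𝓝 0]
      fun y => ‖y‖ ^ 2 := by
    intro p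
    have h := isLittleO_slicePhase_taylor_two (fun e => (⟨ladderField (n₀ := m + 1) (n₁ := m + 1) (n₂ := m₂ + 1) (n₃ := m₃ + 1)
      ![(A : Matrix (Fin N) (Fin N) ℂ), (B : Matrix (Fin N) (Fin N) ℂ), centerPhase N p.1 • (1 : Matrix (Fin N) (Fin N) ℂ),
        centerPhase N p.2 • (1 : Matrix (Fin N) (Fin N) ℂ)] e, hL p e⟩ : Matrix.specialUnitaryGroup (Fin N) ℂ)) (T_V p) k
      (twistedExponent_mk_ladderFieldPair hk hAB p.1 p.2 (hL p))
    refine h.congr' (Eventually.of_forall fun y => ?_) EventuallyEq.rfl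
    simp only [twistedExponent_sliceCfg_eq_slicePhase]
  -- values at the vacua, the zero set, distinct orbits (K9, K2)
  have hf₀ : ∀ p : ZMod N × ZMod N, twistedExponent k ((fun (p : ZMod N × ZMod N) (y : V) => sliceCfg (hL p) (T_V p y)) p 0) = 0 := by
    intro p
    simp only [map_zero, sliceCfg_zero_eq_ladderConfig]
    exact twistedExponent_ladderConfig_pair hk hAB p.1 p.2
  have hzero : ∀ U : FinTorusSite (m + 1) (m + 1) (m₂ + 1) (m₃ + 1) × Fin 4 → Matrix.specialUnitaryGroup (Fin N) ℂ, twistedExponent k U = 0 →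
      ∃ (p : ZMod N × ZMod N) (g : FinTorusSite (m + 1) (m + 1) (m₂ + 1) (m₃ + 1) → Matrix.specialUnitaryGroup (Fin N) ℂ),
        gaugeAct g ((fun (p : ZMod N × ZMod N) (y : V) => sliceCfg (hL p) (T_V p y)) p 0) = U := by
    intro U hU
    obtain ⟨g, i, j, rfl⟩ := (twistedExponent_eq_zero_iff hk hAB U).1 hU
    exact ⟨(i, j), g, by simp only [map_zero, sliceCfg_zero_eq_ladderConfig]⟩
  have hdist : ∀ p q : ZMod N × ZMod N, p ≠ q → ∀ g : FinTorusSite (m + 1) (m + 1) (m₂ + 1) (m₃ + 1) → Matrix.specialUnitaryGroup (Fin N) ℂ,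
      gaugeAct g ((fun (p : ZMod N × ZMod N) (y : V) => sliceCfg (hL p) (T_V p y)) p 0) ≠
        (fun (p : ZMod N × ZMod N) (y : V) => sliceCfg (hL p) (T_V p y)) q 0 := by
    intro p q hpq g h
    apply hpq
    simp only [map_zero, sliceCfg_zero_eq_ladderConfig] at h
    have h' : gaugeAct g (ladderConfig ![A, B, (suCenter N p.1 : Matrix.specialUnitaryGroup (Fin N) ℂ), (suCenter N p.2 : Matrix.specialUnitaryGroup (Fin N) ℂ)]) =
        gaugeAct 1 (ladderConfig ![A, B, (suCenter N q.1 : Matrix.specialUnitaryGroup (Fin N) ℂ), (suCenter N q.2 : Matrix.specialUnitaryGroup (Fin N) ℂ)]) := by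
      rw [gaugeAct_one]; exact h
    obtain ⟨hi, hj, -⟩ := ladder_pair_labels_unique_specialUnitary hk hAB h'
    exact Prod.ext (suCenter_coe_injective hi).symm (suCenter_coe_injective hj).symm
  have hfix : ∀ (p : ZMod N × ZMod N), ∀ s ∈ (fun _ : ZMod N × ZMod N => {g : FinTorusSite (m + 1) (m + 1) (m₂ + 1) (m₃ + 1) → Matrix.specialUnitaryGroup (Fin N) ℂ |
      ∃ c ∈ Subgroup.zpowers (suCenter N k : Matrix.specialUnitaryGroup (Fin N) ℂ), g = fun _ => c}) p, ∀ y : V,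
      gaugeAct s ((fun (p : ZMod N × ZMod N) (y : V) => sliceCfg (hL p) (T_V p y)) p y) = (fun (p : ZMod N × ZMod N) (y : V) => sliceCfg (hL p) (T_V p y)) p y :=
    fun p s hs y => gaugeAct_eq_self_of_mem_constCenterGauge hs _
  -- the Haar chart of the gauge group in the exponential gauge chart (lit-4 L25)
  obtain ⟨U, hd, hUo, h0U, hinjU, hdc, hh0', hh00, hd0eq, hhaar⟩ := exists_haarChart_expGauge_eq T_M
    (Measure.pi fun _ : FinTorusSite (m + 1) (m + 1) (m₂ + 1) (m₃ + 1) => haarProbability (Matrix.specialUnitaryGroup (Fin N) ℂ))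
  have hhc : ContinuousOn hd U := hdc.continuousOn
  have hh0 : ∀ z ∈ U, 0 ≤ hd z := fun z _ => hh0' z
  rw [← hd0eq]
  have hmain := tendsto_laplaceMethod_sum_orbits_closedForm (ι := ZMod N × ZMod N)
    (K := FinTorusSite (m + 1) (m + 1) (m₂ + 1) (m₃ + 1) → Matrix.specialUnitaryGroup (Fin N) ℂ)
    (X := FinTorusSite (m + 1) (m + 1) (m₂ + 1) (m₃ + 1) × Fin 4 → Matrix.specialUnitaryGroup (Fin N) ℂ) (Z := M) (V := V)
    (act := gaugeAct) (σ := fun (p : ZMod N × ZMod N) (y : V) => sliceCfg (hL p) (T_V p y)) (e := fun z : M => expGauge (T_M z))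
    (Θ := fun (p : ZMod N × ZMod N) (q : (FinTorusSite (m + 1) (m + 1) (m₂ + 1) (m₃ + 1) → Matrix.specialUnitaryGroup (Fin N) ℂ) × V) =>
      gaugeAct q.1 (sliceCfg (hL p) (T_V p q.2)))
    (Θ' := fun p : ZMod N × ZMod N => fibredChartMap (hL p) (prodFrame T_M (T_V p)))
    (S := fun _ : ZMod N × ZMod N => {g : FinTorusSite (m + 1) (m + 1) (m₂ + 1) (m₃ + 1) → Matrix.specialUnitaryGroup (Fin N) ℂ |
      ∃ c ∈ Subgroup.zpowers (suCenter N k : Matrix.specialUnitaryGroup (Fin N) ℂ), g = fun _ => c})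
    (ν := Measure.pi fun _ : FinTorusSite (m + 1) (m + 1) (m₂ + 1) (m₃ + 1) => haarProbability (Matrix.specialUnitaryGroup (Fin N) ℂ))
    (μ := Measure.pi fun _ : FinTorusSite (m + 1) (m + 1) (m₂ + 1) (m₃ + 1) × Fin 4 => haarProbability (Matrix.specialUnitaryGroup (Fin N) ℂ))
    (κ := (volume : Measure M))
    (W := fun p : ZMod N × ZMod N => ball (0 : M) (r p) ×ˢ ball (0 : V) (r p))
    (J := fun p : ZMod N × ZMod N => fibredChartDensity (hL p) (slicePsiSuDeriv hAu hBu hω hAB' hNm (hL p)) (prodFrame T_M (T_V p))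
      (Measure.pi fun _ : FinTorusSite (m + 1) (m + 1) (m₂ + 1) (m₃ + 1) × Fin 4 => haarProbability (Matrix.specialUnitaryGroup (Fin N) ℂ)))
    (ρ := fun p : ZMod N × ZMod N => r p / 2)
    (f := twistedExponent k) (φ := φ)
    (A := fun p : ZMod N × ZMod N => sliceHessian (fun e => (⟨ladderField (n₀ := m + 1) (n₁ := m + 1) (n₂ := m₂ + 1) (n₃ := m₃ + 1)
      ![(A : Matrix (Fin N) (Fin N) ℂ), (B : Matrix (Fin N) (Fin N) ℂ), centerPhase N p.1 • (1 : Matrix (Fin N) (Fin N) ℂ),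
        centerPhase N p.2 • (1 : Matrix (Fin N) (Fin N) ℂ)] e, hL p e⟩ : Matrix.specialUnitaryGroup (Fin N) ℂ)) (T_V p) k)
    (f₀ := 0)
    continuous_gaugeAct_uncurry (fun g g' U => gaugeAct_mul g g' U) (fun U => gaugeAct_one U)
    (fun g => measurePreserving_gaugeAct_of_isHaarMeasure g _)
    (fun p => (continuous_sliceCfg (hL p)).comp (T_V p).continuous) (continuous_expGauge.comp T_M.continuous)
    (by simp only [map_zero, expGauge_zero]) (nhds_one_le_map_expGauge_comp T_M)
    (fun p g y => rfl) (fun p z y => fibredChartMap_prodFrame (hL p) T_M (T_V p) z y) hΘ'𝓝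
    (fun p => isOpen_ball.prod isOpen_ball) hinj hJc (fun p w _ => fibredChartDensity_nonneg (hL p) _ _ _ w) hchart
    (fun p => half_pos (hr p)) hρW hstab hfix
    (continuous_twistedExponent k) hφ (fun g U => twistedExponent_gaugeAct k g U) hφinv
    (fun p => sliceHessian_isSymmetric (fun e => (⟨ladderField (n₀ := m + 1) (n₁ := m + 1) (n₂ := m₂ + 1) (n₃ := m₃ + 1) ![(A : Matrix (Fin N) (Fin N) ℂ), (B : Matrix (Fin N) (Fin N) ℂ), centerPhase N p.1 • (1 : Matrix (Fin N) (Fin N) ℂ), centerPhase N p.2 • (1 : Matrix (Fin N) (Fin N) ℂ)] e, hL p e⟩ : Matrix.specialUnitaryGroup (Fin N) ℂ)) (T_V p) k)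
    (fun p y hy => sliceHessian_pos hk hNm _ (twistedExponent_mk_ladderFieldPair hk hAB p.1 p.2 (hL p)) (T_V p) hy)
    hS2 hf₀ (fun U => twistedExponent_nonneg k U) hzero hdist (fun _ => finite_constCenterGauge k) hUo h0U hinjU hhc hh0 hh00 hhaar
  haveI : Nonempty (FinTorusSite (m + 1) (m + 1) (m₂ + 1) (m₃ + 1)) := ⟨((0 : Fin (m + 1)), (0 : Fin (m + 1)), (0 : Fin (m₂ + 1)), (0 : Fin (m₃ + 1)))⟩
  simp only [sub_zero, map_zero, sliceCfg_zero_eq_ladderConfig, ncard_constCenterGauge hk] at hmain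
  exact hmain

end Main

end Summit.QuantumFields.YangMills.Cruxes.IRcof.TwistedSlab

end
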